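import Summits.BirchSwinnertonDyer.BirchSwinnertonDyer.Theorems.KolyvaginDepthDoorDepthTableJLSRows
import Summits.BirchSwinnertonDyer.BirchSwinnertonDyer.Theorems.Rank1ResidualIntModelReduction
import Literature.NumberTheory.EllipticCurves.ComplexMultiplicationNotSemistable
import HarnessLib

/-!
# Route `KolyvaginDepthDoor` — the crux's CONVENTIONS pass the printed data point: the `∃`-body of
# `KolyvaginDepthSupply` (with `5 ≤ p` replaced by `p = 3`) HOLDS at `389a1`, modulo Kolyvagin 1991
# Thm. 4 (printed form) and the JLS computation (crux `KolyvaginDepthSupply`, stmt-BirchSwinnertonDyer-21765)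

Helper file (`--supports stmt-BirchSwinnertonDyer-21765 --as helper`); it closes nothing and BSD is
not proved by it. HONEST FRAMING: the route header names as its CHEAPEST KILL a MISSTATEMENT of the
crux's conventions — "a table where every `c_1(ℓ)` vanishes for a curve with certified `Ш[p] = 0`
signals a MISSTATEMENT of the crux's conventions (levelIndex, class normalisation), the cheapest
kill" — and as its calibration the printed data point "JLS Prop. 3.10 (389a1, p = 3, ℓ = 5, D = 7):
κ_{5,1} ≠ 0 at depth 1 = rank − 1 — consistent (p = 3 is below the crux's p ≥ 5, so it calibrates,
not instantiates)". This file makes the calibration PRECISE: with the JLS row of the companion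
(`C389a1.AtThree.jlsRow_3_neg7_5`) every conjunct of the crux's existential body — good ORDINARY
reduction, surjectivity of `ρ̄_{E,p}`, the Heegner field `K` with `d_K ∉ {−3, −4}`, `p ∤ d_K N`, the
Heegner hypothesis, the parametrisation / Kolyvagin–Heegner data, `n ∈ Λ` (`KolSupp`),
`1 ≤ M ≤ M(n)` (`levelIndex`), the non-vanishing `c_M(n) ≠ 0`, the MINIMALITY of `ν(n)` among all
non-zero classes of the system, and the rank clause `ν(n) + 1 = rank E(ℚ) > rank E^{(d_K)}(ℚ)` — is
PROVED for `E = 389a1` at `p = 3` (`K` of discriminant `−7`, `n = 5`, `M = 1`), modulo the two named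
facts `hK` (Kolyvagin 1991 Thm. 4, printed `B(E)` form) and `hJ` (Jetchev–Lauter–Stein 2009,
Prop. 3.10). So the crux's conventions (`Zhang2014.levelIndex`, McCallum's `kolyvaginClass`, the
minimality conjunct, the twist by `NumberField.discr K`) are jointly SATISFIABLE at real data: the
cheapest kill does not fire on the one printed row. Also recorded: `389a1` is non-CM (the crux's
hypothesis side), unconditionally.

* `C389a1.AtThree.not_hasCM` — `389a1` has multiplicative reduction at `389`, so no CM
  (Silverman ATAEC II.6.4; tree theorem `not_hasMultiplicativeReductionAtPrime_of_hasCM`).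
* `C389a1.AtThree.kolyvaginDepthSupply_body_at_three` — the `∃`-body of `KolyvaginDepthSupply`
  VERBATIM with `5 ≤ p` replaced by `p = 3`, for `W = 389a1`. Minimality: a non-zero class of depth
  `0` would put the minimiser at depth `0`, where Kolyvagin's dichotomy gives `max(c, c') = 1`,
  against `c = corank Sel_{3^∞}(E/ℚ) = 2` (the row); rank clause: `rank E = 2 = ν(5) + 1` and
  `rank E^{(−7)} ≤ c' = 1 < 2` (Kummer on the twist).

What this is NOT: an instance of the crux (`p = 3`, the crux asks `p ≥ 5`); unconditional (two
named facts); a class statement. BSD is not proved by any of this.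

References: [JetchevLauterStein2009] §3.6 Prop. 3.10 (arXiv:0707.0032 p. 8); [Kolyvagin1991MathAnn]
§2 Thm. 4; [WZhang2014] Notations (xii); [GreenbergLNM1716] §1; [SilvermanATAEC1994] Thm. II.6.4.
-/

-- D-0017: single-problem summit, `Summit.BirchSwinnertonDyer.BirchSwinnertonDyer.…` repeats a
-- namespace component by design.
set_option linter.dupNamespace false

noncomputable section

open scoped Classical NumberField

namespace Summit.BirchSwinnertonDyer.BirchSwinnertonDyer.Theorems.KolyvaginDepthDoor

open Literature.NumberTheory.EllipticCurves Literature.NumberTheory.EllipticCurves.ModularForms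
  WeierstrassCurve
open Summit.BirchSwinnertonDyer.BirchSwinnertonDyer.Rank2Observatory
open Summit.BirchSwinnertonDyer.BirchSwinnertonDyer.Rank1Residual

namespace C389a1.AtThree

/-- **`389a1` is not CM** (unconditional): it has multiplicative reduction at `389` (`389 ∣ Δ = 389`,
`389 ∤ c₄ = 112`), and a CM curve over `ℚ` has no multiplicative prime (integral `j`).
[cite: SilvermanATAEC1994, Thm. II.6.4 (PDF p. 148)] [cite: CremonaAlgorithms1997, Table 1 (389a1)] -/
theorem not_hasCM :
    haveI := isElliptic_c389a1;
    ¬ ((⟨0, 1, 1, -2, 0⟩ : WeierstrassCurve ℤ).map (Int.castRingHom ℚ)).HasCM := by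
  haveI := isElliptic_c389a1
  haveI := isGloballyMinimal_c389a1
  haveI := Fact.mk (by norm_num : Nat.Prime 389)
  intro hCM
  exact not_hasMultiplicativeReductionAtPrime_of_hasCM _ hCM 389
    (IntModel.hasMultiplicativeReductionAtPrime_of_intModel intModel 389 (by decide +kernel)
      (by decide +kernel))

/-- **The crux's `∃`-body at the printed data point (modulo Kolyvagin 1991 Thm. 4 in printed form and
JLS 2009 Prop. 3.10).** For `W = 389a1` the statement obtained from the body of
`Theses.KolyvaginDepthDoor.KolyvaginDepthSupply` by replacing `5 ≤ p` with `p = 3` HOLDS: there are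
`p = 3` (good ORDINARY, `ρ̄_{E,3}` onto), an imaginary quadratic `K` (`d_K = −7 ∉ {−3, −4}`, `3 ∤ d_K`,
`3 ∤ N_E`, Heegner hypothesis for `N_E`), a parametrisation datum, `β`, `ι`, `n = 5 ∈ Λ`, a
Kolyvagin–Heegner datum of conductor `5` and `M = 1 ≤ M(5)` with `c_1(5) ≠ 0`, of MINIMAL depth among
all non-zero classes of the system, and `ν(5) + 1 = rank E(ℚ) = 2 > rank E^{(d_K)}(ℚ)`. Witnesses:
the row `jlsRow_3_neg7_5` (`t_3 = 0`, `rank = 2`, `c = 2`, `c' = 1`); minimality because a depth-`0`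
non-zero class would give `max(c, c') = 1` at the minimiser (`exists_minimal_kolyvaginClass_ne_zero_padic`),
against `c = 2`; the twist's rank is `≤ c' = 1` by Kummer. The crux's conventions are thus jointly
satisfiable at real data (the route's "cheapest kill" does not fire); `p = 3` calibrates, the crux asks
`p ≥ 5`. CONDITIONAL on `hK`, `hJ`; per-curve; BSD is not proved by it.
[cite: JetchevLauterStein2009, §3.6 Prop. 3.10 (arXiv:0707.0032 p. 8)]
[cite: Kolyvagin1991MathAnn, §2 Thm. 4 (= typescript Thm. 2.3)] [cite: WZhang2014, Notations (xii)] -/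
theorem kolyvaginDepthSupply_body_at_three
    (hK : Kolyvagin1991_selmerCorank_of_kolyvaginClass_ne_zero_of_padicSurj)
    (hJ : JetchevLauterStein2009_kolyvaginClass_five_ne_zero_at_three) :
    letI W : WeierstrassCurve ℚ := (⟨0, 1, 1, -2, 0⟩ : WeierstrassCurve ℤ).map (Int.castRingHom ℚ)
    haveI := isElliptic_c389a1
    haveI := isGloballyMinimal_c389a1
    ∃ (p : ℕ) (hp : Fact p.Prime), p = 3 ∧ W.HasGoodReductionAtPrime p ∧
      ¬ (p : ℤ) ∣ W.frobeniusTrace p ∧ W.HasSurjectiveModNGaloisRep p ∧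
      ∃ (K : Type) (_ : Field K) (_ : NumberField K), IsImaginaryQuadratic K ∧
        NumberField.discr K ≠ -3 ∧ NumberField.discr K ≠ -4 ∧ ¬ ((p : ℤ) ∣ NumberField.discr K) ∧
        ¬ (p ∣ W.conductorNorm ℤ) ∧ ∃ (_ : NeZero (W.conductorNorm ℤ)),
        SatisfiesHeegnerHypothesis (W.conductorNorm ℤ) K ∧
        ∃ (Dt : ModularParametrizationData W (W.conductorNorm ℤ)) (β : ℤ) (ι : K →+* ℂ) (n : ℕ)
          (d : KolyvaginHeegnerData Dt β ι n) (M : ℕ),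
          KolyvaginDescent.KolSupp (Zhang2014.IsKolyvaginPrime (W.conductorNorm ℤ) W K p) n ∧
          1 ≤ M ∧ (M : ℕ∞) ≤ Zhang2014.levelIndex W p n ∧ d.kolyvaginClass hp.out M ≠ 0 ∧
          (∀ (n' : ℕ) (d' : KolyvaginHeegnerData Dt β ι n') (M' : ℕ),
            KolyvaginDescent.KolSupp (Zhang2014.IsKolyvaginPrime (W.conductorNorm ℤ) W K p) n' →
            1 ≤ M' → (M' : ℕ∞) ≤ Zhang2014.levelIndex W p n' → d'.kolyvaginClass hp.out M' ≠ 0 →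
            n.primeFactors.card ≤ n'.primeFactors.card) ∧
          ((n.primeFactors.card + 1 = W.mordellWeilRank ∧
              (W.quadraticTwist (NumberField.discr K : ℚ)).mordellWeilRank < W.mordellWeilRank) ∨
            (n.primeFactors.card = W.mordellWeilRank ∧
              (W.quadraticTwist (NumberField.discr K : ℚ)).mordellWeilRank =
                W.mordellWeilRank + 1)) := by
  haveI := isElliptic_c389a1
  haveI := isGloballyMinimal_c389a1
  haveI hN : NeZero (((⟨0, 1, 1, -2, 0⟩ : WeierstrassCurve ℤ).map (Int.castRingHom ℚ)).conductorNorm ℤ) :=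
    neZero_conductorNorm_of_isElliptic _
  haveI hp : Fact (Nat.Prime 3) := Fact.mk (by norm_num)
  -- a Heegner field of discriminant `-7`
  obtain ⟨K, iF, iN, hIQ, hD⟩ := exists_isImaginaryQuadratic_discr_eq (D := -7) (by norm_num)
    (Or.inl ⟨by norm_num, Int.squarefree_natAbs.mp (by decide +kernel), by norm_num⟩)
  -- the computed bit (JLS Prop. 3.10) and the filled row
  obtain ⟨Dt, β, ι, d, hne⟩ := hJ.1 K hIQ hD
  obtain ⟨ht, hr, hc, hc'⟩ := jlsRow_3_neg7_5 hK hJ K hIQ hD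
  obtain ⟨hgood, hord⟩ := goodOrdinary_3
  have hsurj : ((⟨0, 1, 1, -2, 0⟩ : WeierstrassCurve ℤ).map (Int.castRingHom ℚ)).HasSurjectiveModNGaloisRep
      (3 : ℕ) := by
    simpa using hasSurjectiveModNGaloisRep_pow_3 1
  obtain ⟨hkol, hlev⟩ := isKolyvaginPrime_5_neg7 K hIQ hD
  have hpN : ¬ (3 ∣ ((⟨0, 1, 1, -2, 0⟩ : WeierstrassCurve ℤ).map (Int.castRingHom ℚ)).conductorNorm ℤ) :=
    fun h ↦ ((((⟨0, 1, 1, -2, 0⟩ : WeierstrassCurve ℤ).map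
      (Int.castRingHom ℚ)).dvd_conductorNorm_iff_not_hasGoodReductionAtPrime 3).mp h) hgood
  have hH : SatisfiesHeegnerHypothesis
      (((⟨0, 1, 1, -2, 0⟩ : WeierstrassCurve ℤ).map (Int.castRingHom ℚ)).conductorNorm ℤ) K :=
    satisfiesHeegnerHypothesis_conductorNorm_of_intModel intModel K hIQ.1 hD C389a1.heegner_neg7
  have hΛ : KolyvaginDescent.KolSupp (Zhang2014.IsKolyvaginPrime
      (((⟨0, 1, 1, -2, 0⟩ : WeierstrassCurve ℤ).map (Int.castRingHom ℚ)).conductorNorm ℤ)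
      ((⟨0, 1, 1, -2, 0⟩ : WeierstrassCurve ℤ).map (Int.castRingHom ℚ)) K 3) 5 :=
    KolyvaginDescent.kolSupp_prime (by norm_num) hkol
  have hcard5 : (5 : ℕ).primeFactors.card = 1 := by
    rw [Nat.Prime.primeFactors (by norm_num), Finset.card_singleton]
  refine ⟨3, hp, rfl, hgood, hord, hsurj, K, iF, iN, hIQ, by rw [hD]; norm_num, by rw [hD]; norm_num,
    by rw [hD]; norm_num, hpN, hN, hH, Dt, β, ι, 5, d, 1, hΛ, le_rfl, hlev, hne, ?_, ?_⟩
  · -- minimality: a non-zero class of depth `0` contradicts `c = 2` at the minimiser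
    intro n' d' M' hΛ' hM' hM'le hne'
    rw [hcard5]
    by_contra hlt
    obtain ⟨n₀, d₀, M₀, -, -, -, -, hle, -, hstruct⟩ :=
      exists_minimal_kolyvaginClass_ne_zero_padic hK _ 3 (by norm_num) hasSurjectiveModNGaloisRep_pow_3
        K hIQ (by rw [hD]; norm_num) (by rw [hD]; norm_num) (by rw [hD]; norm_num) hpN hH Dt β ι n' d'
        M' hΛ' hM' hM'le hne'
    rcases hstruct with ⟨hc0, -, -⟩ | ⟨-, hc0, -⟩ <;> omega
  · -- rank clause: `ν(5) + 1 = 2 = rank E`, and `rank E^{(-7)} ≤ c' = 1 < 2` (Kummer on the twist)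
    left
    refine ⟨by omega, ?_⟩
    have hdK : (NumberField.discr K : ℚ) ≠ 0 := by exact_mod_cast NumberField.discr_ne_zero K
    haveI := ((⟨0, 1, 1, -2, 0⟩ : WeierstrassCurve ℤ).map (Int.castRingHom ℚ)).isElliptic_quadraticTwist hdK
    have hidT := (((⟨0, 1, 1, -2, 0⟩ : WeierstrassCurve ℤ).map (Int.castRingHom ℚ)).quadraticTwist
      (NumberField.discr K : ℚ)).selmerCorank_eq_mordellWeilRank_add_holds 3
    have hc'' : (((⟨0, 1, 1, -2, 0⟩ : WeierstrassCurve ℤ).map (Int.castRingHom ℚ)).quadraticTwist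
        (NumberField.discr K : ℚ)).selmerCorank 3 = 1 := by
      rw [hD]; exact hc'
    omega

end C389a1.AtThree

end Summit.BirchSwinnertonDyer.BirchSwinnertonDyer.Theorems.KolyvaginDepthDoor

end
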